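import Literature.ModelTheory.ExponentialFields.PilaWilkieCubeMaps
import Literature.ModelTheory.ExponentialFields.PilaWilkieParametrizationTools
import Literature.ModelTheory.ExponentialFields.PilaWilkieUnaryParametrizationCr
import Literature.ModelTheory.ExponentialFields.OMinimalCells
import Literature.ModelTheory.ExponentialFields.OMinimalDimension
import HarnessLib

/-!
# `r`-parametrization of cell fibres, uniformly in parameters (Pila–Wilkie 2006, §5, `(II)_m`)

Topic `Literature/ModelTheory/ExponentialFields`; proof file in the cone of the named fact
`PilaWilkie2006_thm_1_8`.  Pila–Wilkie 2006, §5 proves by simultaneous induction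
`(I)_m` (every definable strongly bounded `F : (0,1)^m → M^n` has an `r`-reparametrization) and
`(II)_m` (every strongly bounded definable subset of `M^{m+1}` has an `r`-parametrization), the
step `(II)_m ⇐ (I)_{≤ m}` going through cells: *"it is clearly sufficient to consider the case
that `X` is an `(i₁, …, i_{m+1})`-cell … if `C` is a thin cell … take
`S_C = {I_r(ψ, f ∘ φ_C' ∘ ψ) : ψ ∈ S}` … if `C` is a fat cell … define
`θ(x) = (φ_{C'}∘ψ(x'), (1 − x_{l+1})·f∘φ_{C'}∘ψ(x') + x_{l+1}·g∘φ_{C'}∘ψ(x'))` … apply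
Corollary 5.1"*.

Here this step is carried out over the reals **uniformly in parameters** `v ∈ ℝ^p` (which is
how the counting theorem consumes it, cf. Cor. 5.2): for a cell `C ⊆ ℝ^{p+M}` whose fibres
`C_v = {z | v ⧺ z ∈ C}` lie in `(0,1)^M`, assuming the *uniform* `r`-reparametrization property
`UR(r, ℓ)` of `ℓ`-variable definable families for `ℓ < M` (stated inline; it is proved for
`ℓ = 1` from `uniform_r_parametrization`, and in general in later files), one gets finitely
many definable families of charts `(0,1)^ℓ → C_v` (`ℓ` = number of interval coordinates among
the last `M`), `C^r` with all Fréchet derivatives of order `≤ r` bounded by `1`, covering `C_v`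
whenever `C_v ≠ ∅` (`cellFibreParam`).  Ingredients: `graphStep`, `bandStep` (with the
renormalization grid of `PilaWilkieCubeMaps`), the fibre lemmas `mem_fibre_graph_iff`,
`mem_fibre_band_iff`, clamping (`definableFun_clamp`, to feed possibly unbounded junk values
into `UR`), and the uncurried definability criterion `IsDefinableFamily.of_definableFun`.

Nothing here is a named fact; no definitions.

## References

* J. Pila, A. J. Wilkie, *The rational points of a definable set*, Duke Math. J. 133 (2006),
  §5 (`(II)_m`), Cor. 5.1, Cor. 5.2. [PilaWilkie2006]
* L. van den Dries, *Tame topology and o-minimal structures*, CUP 1998, Ch. 3 (cells).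
  [Dries1998]
-/

noncomputable section

open Set FirstOrder FirstOrder.Language Filter Topology

namespace Literature.ModelTheory.ExponentialFields

/-! ### Helpers: uncurried definability, clamping, fibres of cells -/

section Helpers

variable {L : Language} [L.Structure ℝ]

/-- **Uncurried criterion for definable families**: `Ψ(v, x)` is a definable family as soon as
the function of the concatenated tuple `(v, x)` is definable. [folklore] -/
theorem IsDefinableFamily.of_definableFun {β δ : Type} [Finite β] [Finite δ]
    {Ψ : (β → ℝ) → (δ → ℝ) → ℝ}
    (h : (univ : Set ℝ).DefinableFun L
      (fun w : β ⊕ δ → ℝ => Ψ (fun b => w (Sum.inl b)) (fun d => w (Sum.inr d)))) :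
    IsDefinableFamily L Ψ := by
  intro γ _ q T hq hT
  have hmap : (univ : Set ℝ).DefinableMap L (fun u : γ → ℝ => (Sum.elim (q u) (T u) : β ⊕ δ → ℝ)) := by
    intro i
    cases i with
    | inl b => exact hq b
    | inr d => exact hT d
  exact h.comp hmap

/-- The uncurried function of a definable family is definable. [folklore] -/
theorem IsDefinableFamily.definableFun_uncurry {β δ : Type} [Finite β] [Finite δ]
    {Ψ : (β → ℝ) → (δ → ℝ) → ℝ} (h : IsDefinableFamily L Ψ) :
    (univ : Set ℝ).DefinableFun L
      (fun w : β ⊕ δ → ℝ => Ψ (fun b => w (Sum.inl b)) (fun d => w (Sum.inr d))) :=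
  h.definableFun (fun _ => definableFun_proj _) (fun _ => definableFun_proj _)

/-- The clamp to `[-1, 1]` is a definable function of its argument (with `<` definable).
[folklore] -/
theorem definableFun_clamp {α : Type} [Finite α]
    (hlt : (univ : Set ℝ).Definable L {v : Fin 2 → ℝ | v 0 < v 1})
    {g : (α → ℝ) → ℝ} (hg : (univ : Set ℝ).DefinableFun L g) :
    (univ : Set ℝ).DefinableFun L (fun u => max (-1) (min 1 (g u))) := by
  classical
  have h1 : (univ : Set ℝ).DefinableFun L (fun u : α → ℝ => if g u < 1 then g u else 1) :=
    DefinableFun.ite (definable_setOf_lt hlt hg (definableFun_const' _ _)) hg (definableFun_const' _ _)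
  have h2 : (univ : Set ℝ).DefinableFun L
      (fun u : α → ℝ => if (if g u < 1 then g u else 1) < -1 then -1 else (if g u < 1 then g u else 1)) :=
    DefinableFun.ite (definable_setOf_lt hlt h1 (definableFun_const' _ _)) (definableFun_const' _ _) h1
  convert h2 using 1
  funext u
  have hmin : min 1 (g u) = if g u < 1 then g u else 1 := by
    split_ifs with h
    · exact min_eq_right h.le
    · exact min_eq_left (not_lt.mp h)
  rw [hmin]
  split_ifs with h h' h'
  · exact max_eq_left h'.le
  · exact max_eq_right (not_lt.mp h')
  · exact max_eq_left h'.le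
  · exact max_eq_right (not_lt.mp h')

/-- The clamp is the identity on `[-1, 1]`. [folklore] -/
theorem clamp_eq_self {y : ℝ} (hy : |y| ≤ 1) : max (-1) (min 1 y) = y := by
  rw [abs_le] at hy
  rw [min_eq_right hy.2, max_eq_right hy.1]

/-- The clamp takes values in `[-1, 1]`. [folklore] -/
theorem abs_clamp_le (y : ℝ) : |max (-1) (min 1 y)| ≤ 1 := by
  rw [abs_le]
  exact ⟨le_max_left _ _, max_le (by norm_num) (min_le_left _ _)⟩

/-- **Definable functions of the concatenated tuple**: for a definable `f : ℝ^{p+M} → ℝ`, the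
family `(v, z) ↦ f(v ⧺ z)` (`Fin.append`) is a definable family. [folklore] -/
theorem isDefinableFamily_append {p M : ℕ} {f : (Fin (p + M) → ℝ) → ℝ}
    (hf : (univ : Set ℝ).DefinableFun L f) :
    IsDefinableFamily L (fun (v : Fin p → ℝ) (z : Fin M → ℝ) => f (Fin.append v z)) := by
  apply IsDefinableFamily.of_definableFun
  have hmap : (univ : Set ℝ).DefinableMap L
      (fun w : Fin p ⊕ Fin M → ℝ => (Fin.append (fun b => w (Sum.inl b)) (fun d => w (Sum.inr d)) : Fin (p + M) → ℝ)) := by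
    intro i
    refine Fin.addCases (fun b => ?_) (fun d => ?_) i
    · have : (fun w : Fin p ⊕ Fin M → ℝ => (Fin.append (fun b => w (Sum.inl b)) (fun d => w (Sum.inr d)) : Fin (p + M) → ℝ) (Fin.castAdd M b)) =
          fun w => w (Sum.inl b) := by
        funext w; simp
      rw [this]; exact definableFun_proj _
    · have : (fun w : Fin p ⊕ Fin M → ℝ => (Fin.append (fun b => w (Sum.inl b)) (fun d => w (Sum.inr d)) : Fin (p + M) → ℝ) (Fin.natAdd p d)) =
          fun w => w (Sum.inr d) := by
        funext w; simp
      rw [this]; exact definableFun_proj _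
  exact hf.comp hmap

/-- **Fibres of a graph cell**: the fibre over `v ∈ ℝ^p` of
`Γ = {w | init w ∈ X ∧ w_last = f(init w)} ⊆ ℝ^{p+M+1}` is the graph over the fibre of `X`.
[folklore] -/
theorem mem_fibre_graph_iff {p M : ℕ} {X : Set (Fin (p + M) → ℝ)} {f : (Fin (p + M) → ℝ) → ℝ}
    (v : Fin p → ℝ) (z : Fin (M + 1) → ℝ) :
(Fin.append v z :) ∈
        {w : Fin (p + M + 1) → ℝ | (Fin.init w : Fin (p + M) → ℝ) ∈ X ∧ w (Fin.last (p + M)) = f (Fin.init w)} ↔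
      (Fin.append v (Fin.init z) : Fin (p + M) → ℝ) ∈ X ∧
        z (Fin.last M) = f (Fin.append v (Fin.init z)) := by
  have happ : Fin.append v z = Fin.snoc (Fin.append v (Fin.init z)) (z (Fin.last M)) := by
    conv_lhs => rw [← Fin.snoc_init_self z]
    exact Fin.append_snoc _ _ _
  rw [happ]
  set A : Fin (p + M) → ℝ := Fin.append v (Fin.init z) with hA
  set y : ℝ := z (Fin.last M) with hy
  change (Fin.init (Fin.snoc A y : Fin (p + M + 1) → ℝ) ∈ X ∧
    (Fin.snoc A y : Fin (p + M + 1) → ℝ) (Fin.last (p + M)) = f (Fin.init (Fin.snoc A y : Fin (p + M + 1) → ℝ))) ↔ _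
  rw [Fin.init_snoc, Fin.snoc_last]

/-- **Fibres of a band cell**. [folklore] -/
theorem mem_fibre_band_iff {p M : ℕ} {X : Set (Fin (p + M) → ℝ)} {f g : Option ((Fin (p + M) → ℝ) → ℝ)}
    (v : Fin p → ℝ) (z : Fin (M + 1) → ℝ) :
    (Fin.append v z :) ∈
        {w : Fin (p + M + 1) → ℝ | (Fin.init w : Fin (p + M) → ℝ) ∈ X ∧
          (∀ f' ∈ f, f' (Fin.init w) < w (Fin.last (p + M))) ∧ ∀ g' ∈ g, w (Fin.last (p + M)) < g' (Fin.init w)} ↔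
      (Fin.append v (Fin.init z) : Fin (p + M) → ℝ) ∈ X ∧
        (∀ f' ∈ f, f' (Fin.append v (Fin.init z)) < z (Fin.last M)) ∧
        ∀ g' ∈ g, z (Fin.last M) < g' (Fin.append v (Fin.init z)) := by
  have happ : Fin.append v z = Fin.snoc (Fin.append v (Fin.init z)) (z (Fin.last M)) := by
    conv_lhs => rw [← Fin.snoc_init_self z]
    exact Fin.append_snoc _ _ _
  rw [happ]
  set A : Fin (p + M) → ℝ := Fin.append v (Fin.init z) with hA
  set y : ℝ := z (Fin.last M) with hy
  change (Fin.init (Fin.snoc A y : Fin (p + M + 1) → ℝ) ∈ X ∧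
    (∀ f' ∈ f, f' (Fin.init (Fin.snoc A y : Fin (p + M + 1) → ℝ)) < (Fin.snoc A y : Fin (p + M + 1) → ℝ) (Fin.last (p + M))) ∧
    ∀ g' ∈ g, (Fin.snoc A y : Fin (p + M + 1) → ℝ) (Fin.last (p + M)) < g' (Fin.init (Fin.snoc A y : Fin (p + M + 1) → ℝ))) ↔ _
  rw [Fin.init_snoc, Fin.snoc_last]

end Helpers

/-! ### The graph and band steps of `(II)_m` for cell fibres (Pila–Wilkie 2006, §5) -/

section CellSteps

open Classical

variable {L : Language} [L.Structure ℝ]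

/-- Local notation: the open unit cube `(0,1)^ℓ`. -/
local notation "𝕀^" ℓ:max => (Set.pi Set.univ fun _ : Fin ℓ => Set.Ioo (0 : ℝ) 1)

/-- **The graph step** (Pila–Wilkie 2006, §5, proof of `(II)_m`: *"if `C` is also a thin cell,
that is, `C` is the graph of some definable, strongly bounded, continuous function
`f : C' → M`, then … by `(I)_l` there exists an `r`-reparametrization, `S` say, of
`(φ_C', f ∘ φ_C')`. Clearly we may now take `S_C = {I_r(ψ, f ∘ φ_C' ∘ ψ) : ψ ∈ S}`"*),
uniformly in parameters `v ∈ ℝ^p`: given uniformly definable charts `φ'_i(v,·) : (0,1)^ℓ → S'_v`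
of the fibres `S'_v ⊆ ℝ^M` (covering, `C^r`, all derivatives `≤ 1`, whenever `S'_v ≠ ∅`), a
definable `f : ℝ^{p+M} → ℝ`, and the uniform `r`-reparametrization property of `ℓ`-variable
families, one gets such charts for the graph fibres
`S_v = {z ∈ ℝ^{M+1} | init z ∈ S'_v, z_M = f(v ⧺ init z)}`, provided all `S_v ⊆ (0,1)^{M+1}`.
[cite: PilaWilkie2006, §5 (II)_m] -/
theorem graphStep {p M ℓ r : ℕ}
    (hlt : (univ : Set ℝ).Definable L {v : Fin 2 → ℝ | v 0 < v 1})
    (hUR : ∀ (n m : ℕ) (F : Fin n → (Fin m → ℝ) → (Fin ℓ → ℝ) → ℝ),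
      (∀ l, IsDefinableFamily L (F l)) → (∀ l v, ∀ x ∈ 𝕀^ℓ, |F l v x| ≤ 1) →
      ∃ (κ : Type) (_ : Fintype κ) (ψ : κ → (Fin m → ℝ) → (Fin ℓ → ℝ) → (Fin ℓ → ℝ)),
        (∀ j c, IsDefinableFamily L (fun v x => ψ j v x c)) ∧
        ∀ v, (∀ j, MapsTo (ψ j v) (𝕀^ℓ) (𝕀^ℓ)) ∧ (⋃ j, ψ j v '' 𝕀^ℓ) = 𝕀^ℓ ∧
          (∀ j c, ContDiffOn ℝ r (fun x => ψ j v x c) (𝕀^ℓ)) ∧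
          (∀ j c, ∀ q ≤ r, ∀ x ∈ 𝕀^ℓ, ‖iteratedFDeriv ℝ q (fun x => ψ j v x c) x‖ ≤ 1) ∧
          (∀ j l, ContDiffOn ℝ r (fun x => F l v (ψ j v x)) (𝕀^ℓ)) ∧
          (∀ j l, ∀ q ≤ r, ∀ x ∈ 𝕀^ℓ, ‖iteratedFDeriv ℝ q (fun x => F l v (ψ j v x)) x‖ ≤ 1))
    (S' : (Fin p → ℝ) → Set (Fin M → ℝ)) {f : (Fin (p + M) → ℝ) → ℝ}
    (hf : (univ : Set ℝ).DefinableFun L f)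
    {κ' : Type} [Fintype κ'] {φ' : κ' → (Fin p → ℝ) → (Fin ℓ → ℝ) → (Fin M → ℝ)}
    (hφ'def : ∀ i c, IsDefinableFamily L (fun v x => φ' i v x c))
    (hφ' : ∀ v, (S' v).Nonempty →
      (∀ i, MapsTo (φ' i v) (𝕀^ℓ) (S' v)) ∧ (⋃ i, φ' i v '' 𝕀^ℓ) = S' v ∧
      (∀ i c, ContDiffOn ℝ r (fun x => φ' i v x c) (𝕀^ℓ)) ∧
      (∀ i c, ∀ q ≤ r, ∀ x ∈ 𝕀^ℓ, ‖iteratedFDeriv ℝ q (fun x => φ' i v x c) x‖ ≤ 1))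
    (hS : ∀ v, {z : Fin (M + 1) → ℝ | Fin.init z ∈ S' v ∧ z (Fin.last M) = f (Fin.append v (Fin.init z))} ⊆ 𝕀^(M + 1)) :
    ∃ (κ : Type) (_ : Fintype κ) (φ : κ → (Fin p → ℝ) → (Fin ℓ → ℝ) → (Fin (M + 1) → ℝ)),
      (∀ i c, IsDefinableFamily L (fun v x => φ i v x c)) ∧
      ∀ v, {z : Fin (M + 1) → ℝ | Fin.init z ∈ S' v ∧ z (Fin.last M) = f (Fin.append v (Fin.init z))}.Nonempty →
        (∀ i, MapsTo (φ i v) (𝕀^ℓ)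
          {z : Fin (M + 1) → ℝ | Fin.init z ∈ S' v ∧ z (Fin.last M) = f (Fin.append v (Fin.init z))}) ∧
        (⋃ i, φ i v '' 𝕀^ℓ) =
          {z : Fin (M + 1) → ℝ | Fin.init z ∈ S' v ∧ z (Fin.last M) = f (Fin.append v (Fin.init z))} ∧
        (∀ i c, ContDiffOn ℝ r (fun x => φ i v x c) (𝕀^ℓ)) ∧
        (∀ i c, ∀ q ≤ r, ∀ x ∈ 𝕀^ℓ, ‖iteratedFDeriv ℝ q (fun x => φ i v x c) x‖ ≤ 1) := by
  -- the graph point over `φ' i v x'` and its clamped coordinates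
  set G : κ' → (Fin p → ℝ) → (Fin ℓ → ℝ) → (Fin (M + 1) → ℝ) := fun i v x' =>
    Fin.snoc (φ' i v x') (f (Fin.append v (φ' i v x'))) with hG
  set F : κ' → Fin (M + 1) → (Fin p → ℝ) → (Fin ℓ → ℝ) → ℝ := fun i c v x' =>
    max (-1) (min 1 (G i v x' c)) with hF
  -- definability
  have hGdef : ∀ i c, IsDefinableFamily L (fun v x' => G i v x' c) := by
    intro i c
    refine Fin.lastCases ?_ (fun c' => ?_) c
    · simp only [hG, Fin.snoc_last]
      apply IsDefinableFamily.of_definableFun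
      have hmap : (univ : Set ℝ).DefinableMap L (fun w : Fin p ⊕ Fin ℓ → ℝ =>
          (Fin.append (fun b => w (Sum.inl b)) (φ' i (fun b => w (Sum.inl b)) (fun d => w (Sum.inr d))) : Fin (p + M) → ℝ)) := by
        intro k
        refine Fin.addCases (fun b => ?_) (fun d => ?_) k
        · have : (fun w : Fin p ⊕ Fin ℓ → ℝ => (Fin.append (fun b => w (Sum.inl b))
              (φ' i (fun b => w (Sum.inl b)) (fun d => w (Sum.inr d))) : Fin (p + M) → ℝ) (Fin.castAdd M b)) =
              fun w => w (Sum.inl b) := by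
            funext w; simp
          rw [this]; exact definableFun_proj _
        · have : (fun w : Fin p ⊕ Fin ℓ → ℝ => (Fin.append (fun b => w (Sum.inl b))
              (φ' i (fun b => w (Sum.inl b)) (fun d => w (Sum.inr d))) : Fin (p + M) → ℝ) (Fin.natAdd p d)) =
              fun w => φ' i (fun b => w (Sum.inl b)) (fun d => w (Sum.inr d)) d := by
            funext w; simp
          rw [this]; exact (hφ'def i d).definableFun_uncurry
      exact hf.comp hmap
    · simp only [hG, Fin.snoc_castSucc]
      exact hφ'def i c'
  have hFdef : ∀ i c, IsDefinableFamily L (F i c) := by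
    intro i c
    apply IsDefinableFamily.of_definableFun
    simp only [hF]
    exact definableFun_clamp hlt (hGdef i c).definableFun_uncurry
  have hFbd : ∀ i c v, ∀ x ∈ 𝕀^ℓ, |F i c v x| ≤ 1 := fun i c v x _ => abs_clamp_le _
  -- apply the uniform reparametrization to each `F i`
  choose κ hκ ψ hψdef hψ using fun i => hUR (M + 1) p (F i) (hFdef i) (hFbd i)
  -- the new charts
  set θ : (Σ i, κ i) → (Fin p → ℝ) → (Fin ℓ → ℝ) → (Fin (M + 1) → ℝ) := fun ij v x =>
    G ij.1 v (ψ ij.1 ij.2 v x) with hθ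
  have hθdef : ∀ ij c, IsDefinableFamily L (fun v x => θ ij v x c) := by
    rintro ⟨i, j⟩ c
    intro γ _ q T hq hT
    have hT' : (univ : Set ℝ).DefinableMap L (fun u : γ → ℝ => ψ i j (q u) (T u)) :=
      fun c'' => (hψdef i j c'') γ q T hq hT
    exact (hGdef i c) γ q (fun u => ψ i j (q u) (T u)) hq hT'
  refine ⟨Σ i, κ i, inferInstance, θ, hθdef, fun v hne => ?_⟩
  -- the base fibre is non-empty, so the input charts are good at `v`
  have hne' : (S' v).Nonempty := by
    obtain ⟨z, hz, -⟩ := hne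
    exact ⟨_, hz⟩
  obtain ⟨hmaps', hcov', hCr', hbd'⟩ := hφ' v hne'
  set S : Set (Fin (M + 1) → ℝ) :=
    {z : Fin (M + 1) → ℝ | Fin.init z ∈ S' v ∧ z (Fin.last M) = f (Fin.append v (Fin.init z))} with hSdef
  -- the graph point lies in the fibre, hence in the cube
  have hGmem : ∀ i, ∀ x' ∈ 𝕀^ℓ, G i v x' ∈ S := by
    intro i x' hx'
    refine ⟨?_, ?_⟩
    · simp only [hG, Fin.init_snoc]; exact hmaps' i hx'
    · simp only [hG, Fin.snoc_last, Fin.init_snoc]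
  have hGcube : ∀ i, ∀ x' ∈ 𝕀^ℓ, G i v x' ∈ 𝕀^(M + 1) := fun i x' hx' => hS v (hGmem i x' hx')
  have hFG : ∀ i c, ∀ x' ∈ 𝕀^ℓ, F i c v x' = G i v x' c := by
    intro i c x' hx'
    simp only [hF]
    apply clamp_eq_self
    have h := hGcube i x' hx' c (mem_univ _)
    rw [abs_le]; exact ⟨by linarith [h.1], h.2.le⟩
  have hopen : IsOpen (𝕀^ℓ) := isOpen_set_pi finite_univ fun _ _ => isOpen_Ioo
  refine ⟨?_, ?_, ?_, ?_⟩
  · -- maps into the fibre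
    rintro ⟨i, j⟩ x hx
    exact hGmem i _ ((hψ i v).1 j hx)
  · -- covering
    apply Subset.antisymm
    · exact iUnion_subset fun ij => by
        rintro _ ⟨x, hx, rfl⟩
        exact hGmem ij.1 _ ((hψ ij.1 v).1 ij.2 hx)
    · intro z hz
      have hz1 : Fin.init z ∈ S' v := hz.1
      rw [← hcov'] at hz1
      obtain ⟨i, x', hx', hx'z⟩ := mem_iUnion.mp hz1
      have hx'cov : x' ∈ ⋃ j, ψ i j v '' 𝕀^ℓ := by rw [(hψ i v).2.1]; exact hx'
      obtain ⟨j, x, hx, rfl⟩ := mem_iUnion.mp hx'cov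
      refine mem_iUnion.mpr ⟨⟨i, j⟩, x, hx, ?_⟩
      show G i v (ψ i j v x) = z
      simp only [hG]
      rw [hx'z, ← hz.2]
      exact Fin.snoc_init_self z
  · -- smoothness: `θ = F ∘ ψ` on the cube
    rintro ⟨i, j⟩ c
    have h := (hψ i v).2.2.2.2.1 j c
    refine h.congr fun x hx => ?_
    show G i v (ψ i j v x) c = F i c v (ψ i j v x)
    rw [hFG i c _ ((hψ i v).1 j hx)]
  · -- bounds
    rintro ⟨i, j⟩ c q hq x hx
    have h := (hψ i v).2.2.2.2.2 j c q hq x hx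
    have heq : EqOn (fun x => θ ⟨i, j⟩ v x c) (fun x => F i c v (ψ i j v x)) (𝕀^ℓ) := fun y hy => by
      show G i v (ψ i j v y) c = F i c v (ψ i j v y)
      rw [hFG i c _ ((hψ i v).1 j hy)]
    rw [← iteratedFDerivWithin_of_isOpen q hopen hx, iteratedFDerivWithin_congr heq hx,
      iteratedFDerivWithin_of_isOpen q hopen hx]
    exact h

/-- **The band step** (Pila–Wilkie 2006, §5, proof of `(II)_m`: *"if `C` is a fat cell, then
… `C = (f, g)_{C'}` … apply the inductive hypothesis `(I)_l` to obtain an `r`-reparametrization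
`S` of the function `⟨φ_{C'}, f∘φ_{C'}, g∘φ_{C'}⟩` … for each `ψ ∈ S`, define `θ(x) =
(φ_{C'}∘ψ(x'), (1 − x_{l+1})·f∘φ_{C'}∘ψ(x') + x_{l+1}·g∘φ_{C'}∘ψ(x'))` … apply Corollary 5.1
and we are done"*), uniformly in parameters: from uniform charts of the fibres `S'_v ⊆ ℝ^M`
by `(0,1)^ℓ`, definable `f < g` on the base, and the uniform `r`-reparametrization property of
`ℓ`-variable families, uniform charts by `(0,1)^{ℓ+1}` of the band fibres
`S_v = {z | init z ∈ S'_v, f(v ⧺ init z) < z_M < g(v ⧺ init z)}`, provided all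
`S_v ⊆ (0,1)^{M+1}`; the renormalization to bounds `1` uses the subdivision grid with
`K = 2^{r+1}`. [cite: PilaWilkie2006, §5 (II)_m and Cor. 5.1] -/
theorem bandStep {p M ℓ r : ℕ}
    (hadd : (univ : Set ℝ).Definable L {v : Fin 3 → ℝ | v 0 + v 1 = v 2})
    (hmul : (univ : Set ℝ).Definable L {v : Fin 3 → ℝ | v 0 * v 1 = v 2})
    (hUR : ∀ (n m : ℕ) (F : Fin n → (Fin m → ℝ) → (Fin ℓ → ℝ) → ℝ),
      (∀ l, IsDefinableFamily L (F l)) → (∀ l v, ∀ x ∈ 𝕀^ℓ, |F l v x| ≤ 1) →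
      ∃ (κ : Type) (_ : Fintype κ) (ψ : κ → (Fin m → ℝ) → (Fin ℓ → ℝ) → (Fin ℓ → ℝ)),
        (∀ j c, IsDefinableFamily L (fun v x => ψ j v x c)) ∧
        ∀ v, (∀ j, MapsTo (ψ j v) (𝕀^ℓ) (𝕀^ℓ)) ∧ (⋃ j, ψ j v '' 𝕀^ℓ) = 𝕀^ℓ ∧
          (∀ j c, ContDiffOn ℝ r (fun x => ψ j v x c) (𝕀^ℓ)) ∧
          (∀ j c, ∀ q ≤ r, ∀ x ∈ 𝕀^ℓ, ‖iteratedFDeriv ℝ q (fun x => ψ j v x c) x‖ ≤ 1) ∧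
          (∀ j l, ContDiffOn ℝ r (fun x => F l v (ψ j v x)) (𝕀^ℓ)) ∧
          (∀ j l, ∀ q ≤ r, ∀ x ∈ 𝕀^ℓ, ‖iteratedFDeriv ℝ q (fun x => F l v (ψ j v x)) x‖ ≤ 1))
    (S' : (Fin p → ℝ) → Set (Fin M → ℝ)) {f g : (Fin (p + M) → ℝ) → ℝ}
    (hf : (univ : Set ℝ).DefinableFun L f) (hg : (univ : Set ℝ).DefinableFun L g)
    (hfg : ∀ v, ∀ z' ∈ S' v, f (Fin.append v z') < g (Fin.append v z'))
    {κ' : Type} [Fintype κ'] {φ' : κ' → (Fin p → ℝ) → (Fin ℓ → ℝ) → (Fin M → ℝ)}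
    (hφ'def : ∀ i c, IsDefinableFamily L (fun v x => φ' i v x c))
    (hφ' : ∀ v, (S' v).Nonempty →
      (∀ i, MapsTo (φ' i v) (𝕀^ℓ) (S' v)) ∧ (⋃ i, φ' i v '' 𝕀^ℓ) = S' v ∧
      (∀ i c, ContDiffOn ℝ r (fun x => φ' i v x c) (𝕀^ℓ)) ∧
      (∀ i c, ∀ q ≤ r, ∀ x ∈ 𝕀^ℓ, ‖iteratedFDeriv ℝ q (fun x => φ' i v x c) x‖ ≤ 1))
    (hS : ∀ v, {z : Fin (M + 1) → ℝ | Fin.init z ∈ S' v ∧ f (Fin.append v (Fin.init z)) < z (Fin.last M) ∧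
      z (Fin.last M) < g (Fin.append v (Fin.init z))} ⊆ 𝕀^(M + 1)) :
    ∃ (κ : Type) (_ : Fintype κ) (φ : κ → (Fin p → ℝ) → (Fin (ℓ + 1) → ℝ) → (Fin (M + 1) → ℝ)),
      (∀ i c, IsDefinableFamily L (fun v x => φ i v x c)) ∧
      ∀ v, {z : Fin (M + 1) → ℝ | Fin.init z ∈ S' v ∧ f (Fin.append v (Fin.init z)) < z (Fin.last M) ∧
          z (Fin.last M) < g (Fin.append v (Fin.init z))}.Nonempty →
        (∀ i, MapsTo (φ i v) (𝕀^(ℓ + 1)) {z : Fin (M + 1) → ℝ | Fin.init z ∈ S' v ∧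
          f (Fin.append v (Fin.init z)) < z (Fin.last M) ∧ z (Fin.last M) < g (Fin.append v (Fin.init z))}) ∧
        (⋃ i, φ i v '' 𝕀^(ℓ + 1)) = {z : Fin (M + 1) → ℝ | Fin.init z ∈ S' v ∧
          f (Fin.append v (Fin.init z)) < z (Fin.last M) ∧ z (Fin.last M) < g (Fin.append v (Fin.init z))} ∧
        (∀ i c, ContDiffOn ℝ r (fun x => φ i v x c) (𝕀^(ℓ + 1))) ∧
        (∀ i c, ∀ q ≤ r, ∀ x ∈ 𝕀^(ℓ + 1), ‖iteratedFDeriv ℝ q (fun x => φ i v x c) x‖ ≤ 1) := by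
  have hlt := definable_lt_of_field hadd hmul
  -- the tuple `(φ', f∘φ', g∘φ')` over `x'` and its clamped coordinates
  set G : κ' → (Fin p → ℝ) → (Fin ℓ → ℝ) → (Fin (M + 2) → ℝ) := fun i v x' =>
    Fin.snoc (Fin.snoc (φ' i v x') (f (Fin.append v (φ' i v x')))) (g (Fin.append v (φ' i v x'))) with hG
  set F : κ' → Fin (M + 2) → (Fin p → ℝ) → (Fin ℓ → ℝ) → ℝ := fun i c v x' =>
    max (-1) (min 1 (G i v x' c)) with hF
  -- definability of `x' ↦ h (v ⧺ φ' i v x')` for definable `h`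
  have hcompdef : ∀ i (h : (Fin (p + M) → ℝ) → ℝ), (univ : Set ℝ).DefinableFun L h →
      IsDefinableFamily L (fun v x' => h (Fin.append v (φ' i v x'))) := by
    intro i h hh
    apply IsDefinableFamily.of_definableFun
    have hmap : (univ : Set ℝ).DefinableMap L (fun w : Fin p ⊕ Fin ℓ → ℝ =>
        (Fin.append (fun b => w (Sum.inl b)) (φ' i (fun b => w (Sum.inl b)) (fun d => w (Sum.inr d))) : Fin (p + M) → ℝ)) := by
      intro k
      refine Fin.addCases (fun b => ?_) (fun d => ?_) k
      · have : (fun w : Fin p ⊕ Fin ℓ → ℝ => (Fin.append (fun b => w (Sum.inl b))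
            (φ' i (fun b => w (Sum.inl b)) (fun d => w (Sum.inr d))) : Fin (p + M) → ℝ) (Fin.castAdd M b)) =
            fun w => w (Sum.inl b) := by
          funext w; simp
        rw [this]; exact definableFun_proj _
      · have : (fun w : Fin p ⊕ Fin ℓ → ℝ => (Fin.append (fun b => w (Sum.inl b))
            (φ' i (fun b => w (Sum.inl b)) (fun d => w (Sum.inr d))) : Fin (p + M) → ℝ) (Fin.natAdd p d)) =
            fun w => φ' i (fun b => w (Sum.inl b)) (fun d => w (Sum.inr d)) d := by
          funext w; simp
        rw [this]; exact (hφ'def i d).definableFun_uncurry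
    exact hh.comp hmap
  have hGdef : ∀ i c, IsDefinableFamily L (fun v x' => G i v x' c) := by
    intro i c
    refine Fin.lastCases ?_ (fun c' => ?_) c
    · simp only [hG, Fin.snoc_last]
      exact hcompdef i g hg
    · simp only [hG, Fin.snoc_castSucc]
      refine Fin.lastCases ?_ (fun c'' => ?_) c'
      · simp only [Fin.snoc_last]
        exact hcompdef i f hf
      · simp only [Fin.snoc_castSucc]
        exact hφ'def i c''
  have hFdef : ∀ i c, IsDefinableFamily L (F i c) := by
    intro i c
    apply IsDefinableFamily.of_definableFun
    simp only [hF]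
    exact definableFun_clamp hlt (hGdef i c).definableFun_uncurry
  have hFbd : ∀ i c v, ∀ x ∈ 𝕀^ℓ, |F i c v x| ≤ 1 := fun i c v x _ => abs_clamp_le _
  choose κ hκ ψ hψdef hψ using fun i => hUR (M + 2) p (F i) (hFdef i) (hFbd i)
  -- the pre-charts `η` on `(0,1)^{ℓ+1}` and the grid
  set fv : κ' → (Fin p → ℝ) → (Fin ℓ → ℝ) → ℝ := fun i v x' => f (Fin.append v (φ' i v x')) with hfv
  set gv : κ' → (Fin p → ℝ) → (Fin ℓ → ℝ) → ℝ := fun i v x' => g (Fin.append v (φ' i v x')) with hgv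
  set η : (Σ i, κ i) → (Fin p → ℝ) → (Fin (ℓ + 1) → ℝ) → (Fin (M + 1) → ℝ) := fun ij v x =>
    Fin.snoc (φ' ij.1 v (ψ ij.1 ij.2 v (Fin.init x)))
      ((1 - x (Fin.last ℓ)) * fv ij.1 v (ψ ij.1 ij.2 v (Fin.init x)) +
        x (Fin.last ℓ) * gv ij.1 v (ψ ij.1 ij.2 v (Fin.init x))) with hη
  set K : ℕ := 2 ^ (r + 1) with hK
  have hK1 : 1 ≤ K := Nat.one_le_two_pow
  have hKR : (K : ℝ) = 2 ^ (r + 1) := by rw [hK]; norm_num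
  have hK0 : (0 : ℝ) < K := by rw [hKR]; positivity
  set A : (Fin (ℓ + 1) → Fin (2 * K - 1)) → (Fin (ℓ + 1) → ℝ) → (Fin (ℓ + 1) → ℝ) := fun a x =>
    (fun i => ((a i : ℕ) : ℝ) / (2 * K)) + (1 / K : ℝ) • x with hA
  obtain ⟨hAmaps, hAcov⟩ := subdivision_grid (ℓ := ℓ + 1) hK1
  set θ : (Σ i, κ i) × (Fin (ℓ + 1) → Fin (2 * K - 1)) → (Fin p → ℝ) → (Fin (ℓ + 1) → ℝ) → (Fin (M + 1) → ℝ) :=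
    fun ija v x => η ija.1 v (A ija.2 x) with hθ
  -- definability
  have hψmap : ∀ i j {γ : Type} [Finite γ] (q : (γ → ℝ) → Fin p → ℝ) (T : (γ → ℝ) → Fin ℓ → ℝ),
      (univ : Set ℝ).DefinableMap L q → (univ : Set ℝ).DefinableMap L T →
      (univ : Set ℝ).DefinableMap L (fun u => ψ i j (q u) (T u)) :=
    fun i j γ _ q T hq hT c => (hψdef i j c) γ q T hq hT
  have hηdef : ∀ ij c, IsDefinableFamily L (fun v x => η ij v x c) := by
    rintro ⟨i, j⟩ c
    intro γ _ q T hq hT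
    have hinit : (univ : Set ℝ).DefinableMap L (fun u : γ → ℝ => Fin.init (T u)) := fun d => hT (Fin.castSucc d)
    have hlast : (univ : Set ℝ).DefinableFun L (fun u : γ → ℝ => T u (Fin.last ℓ)) := hT (Fin.last ℓ)
    have hψT := hψmap i j q (fun u => Fin.init (T u)) hq hinit
    refine Fin.lastCases ?_ (fun c' => ?_) c
    · simp only [hη, Fin.snoc_last]
      refine definableFun_add hadd (definableFun_mul hmul (definableFun_sub hadd (definableFun_const' _ _) hlast) ?_)
        (definableFun_mul hmul hlast ?_)
      · exact (hcompdef i f hf) γ q _ hq hψT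
      · exact (hcompdef i g hg) γ q _ hq hψT
    · simp only [hη, Fin.snoc_castSucc]
      exact (hφ'def i c') γ q _ hq hψT
  have hAdef : ∀ a, (univ : Set ℝ).DefinableMap L (fun x : Fin (ℓ + 1) → ℝ => A a x) := by
    intro a i
    simp only [hA, Pi.add_apply, Pi.smul_apply, smul_eq_mul]
    exact definableFun_add hadd (definableFun_const' _ _) (definableFun_mul hmul (definableFun_const' _ _) (definableFun_proj _))
  have hθdef : ∀ ija c, IsDefinableFamily L (fun v x => θ ija v x c) := by
    rintro ⟨ij, a⟩ c
    intro γ _ q T hq hT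
    have hAT : (univ : Set ℝ).DefinableMap L (fun u : γ → ℝ => A a (T u)) := fun i => (hAdef a i).comp hT
    exact (hηdef ij c) γ q _ hq hAT
  refine ⟨(Σ i, κ i) × (Fin (ℓ + 1) → Fin (2 * K - 1)), inferInstance, θ, hθdef, fun v hne => ?_⟩
  -- at a parameter with non-empty fibre
  set S : Set (Fin (M + 1) → ℝ) := {z : Fin (M + 1) → ℝ | Fin.init z ∈ S' v ∧
    f (Fin.append v (Fin.init z)) < z (Fin.last M) ∧ z (Fin.last M) < g (Fin.append v (Fin.init z))} with hSdef
  have hne' : (S' v).Nonempty := by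
    obtain ⟨z, hz, -⟩ := hne
    exact ⟨_, hz⟩
  obtain ⟨hmaps', hcov', hCr', hbd'⟩ := hφ' v hne'
  have hopen : IsOpen (𝕀^ℓ) := isOpen_set_pi finite_univ fun _ _ => isOpen_Ioo
  have hopen1 : IsOpen (𝕀^(ℓ + 1)) := isOpen_set_pi finite_univ fun _ _ => isOpen_Ioo
  -- values of `f`, `g` over the base fibre lie in `[0, 1]`
  have hfg01 : ∀ z' ∈ S' v, 0 ≤ f (Fin.append v z') ∧ g (Fin.append v z') ≤ 1 := by
    intro z' hz'
    have hlt' := hfg v z' hz'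
    constructor
    · by_contra hneg
      push Not at hneg
      -- a point of the band below `0`
      set y : ℝ := (f (Fin.append v z') + min 0 (g (Fin.append v z'))) / 2 with hy
      have hy1 : f (Fin.append v z') < y := by
        rw [hy]; have hm : f (Fin.append v z') < min 0 (g (Fin.append v z')) := lt_min hneg hlt'; linarith
      have hy2 : y < g (Fin.append v z') := by
        rw [hy]; have := min_le_right (0 : ℝ) (g (Fin.append v z')); linarith
      have hy0 : y < 0 := by
        rw [hy]; have := min_le_left (0 : ℝ) (g (Fin.append v z')); linarith
      have hmem : (Fin.snoc z' y : Fin (M + 1) → ℝ) ∈ S := by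
        refine ⟨?_, ?_, ?_⟩ <;> simp only [Fin.init_snoc, Fin.snoc_last]
        · exact hz'
        · exact hy1
        · exact hy2
      have h := (hS v hmem) (Fin.last M) (mem_univ _)
      simp only [Fin.snoc_last] at h
      linarith [h.1]
    · by_contra hneg
      push Not at hneg
      set y : ℝ := (max 1 (f (Fin.append v z')) + g (Fin.append v z')) / 2 with hy
      have hy1 : f (Fin.append v z') < y := by
        rw [hy]; have := le_max_right (1 : ℝ) (f (Fin.append v z')); linarith
      have hy2 : y < g (Fin.append v z') := by
        rw [hy]; have := max_lt hneg hlt'; linarith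
      have hy0 : 1 < y := by
        rw [hy]; have := le_max_left (1 : ℝ) (f (Fin.append v z')); linarith
      have hmem : (Fin.snoc z' y : Fin (M + 1) → ℝ) ∈ S := by
        refine ⟨?_, ?_, ?_⟩ <;> simp only [Fin.init_snoc, Fin.snoc_last]
        · exact hz'
        · exact hy1
        · exact hy2
      have h := (hS v hmem) (Fin.last M) (mem_univ _)
      simp only [Fin.snoc_last] at h
      linarith [h.2]
  -- the clamped coordinates agree with the true ones on the cube
  have hS'cube : S' v ⊆ 𝕀^M := by
    intro z' hz'
    set y : ℝ := (f (Fin.append v z') + g (Fin.append v z')) / 2 with hy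
    have hlt' := hfg v z' hz'
    have hmem : (Fin.snoc z' y : Fin (M + 1) → ℝ) ∈ S := by
      refine ⟨?_, ?_, ?_⟩ <;> simp only [Fin.init_snoc, Fin.snoc_last]
      · exact hz'
      · rw [hy]; linarith
      · rw [hy]; linarith
    intro c _
    have h := (hS v hmem) (Fin.castSucc c) (mem_univ _)
    simpa only [Fin.snoc_castSucc] using h
  have hGabs : ∀ i c, ∀ x' ∈ 𝕀^ℓ, |G i v x' c| ≤ 1 := by
    intro i c x' hx'
    have hmem := hmaps' i hx'
    refine Fin.lastCases ?_ (fun c' => ?_) c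
    · simp only [hG, Fin.snoc_last]
      have h1 := (hfg01 _ hmem).2
      have h0 : 0 ≤ g (Fin.append v (φ' i v x')) := (hfg01 _ hmem).1.trans (hfg v _ hmem).le
      rw [abs_le]; exact ⟨by linarith, h1⟩
    · simp only [hG, Fin.snoc_castSucc]
      refine Fin.lastCases ?_ (fun c'' => ?_) c'
      · simp only [Fin.snoc_last]
        have h0 := (hfg01 _ hmem).1
        have h1 : f (Fin.append v (φ' i v x')) ≤ 1 := (hfg v _ hmem).le.trans (hfg01 _ hmem).2
        rw [abs_le]; exact ⟨by linarith, h1⟩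
      · simp only [Fin.snoc_castSucc]
        have h := hS'cube hmem c'' (mem_univ _)
        rw [abs_le]; exact ⟨by linarith [h.1], h.2.le⟩
  have hFG : ∀ i c, ∀ x' ∈ 𝕀^ℓ, F i c v x' = G i v x' c := fun i c x' hx' => by
    simp only [hF]; exact clamp_eq_self (hGabs i c x' hx')
  -- unary pieces over `ψ`: `φ'`-coordinates, `f`- and `g`-values, all with bounds `1`
  have hpiece : ∀ i j (c : Fin (M + 2)),
      ContDiffOn ℝ r (fun x' => G i v (ψ i j v x') c) (𝕀^ℓ) ∧
      ∀ q ≤ r, ∀ x' ∈ 𝕀^ℓ, ‖iteratedFDeriv ℝ q (fun x' => G i v (ψ i j v x') c) x'‖ ≤ 1 := by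
    intro i j c
    have heq : EqOn (fun x' => G i v (ψ i j v x') c) (fun x' => F i c v (ψ i j v x')) (𝕀^ℓ) :=
      fun x' hx' => (hFG i c _ ((hψ i v).1 j hx')).symm
    refine ⟨((hψ i v).2.2.2.2.1 j c).congr heq, fun q hq x' hx' => ?_⟩
    rw [← iteratedFDerivWithin_of_isOpen q hopen hx', iteratedFDerivWithin_congr heq hx',
      iteratedFDerivWithin_of_isOpen q hopen hx']
    exact (hψ i v).2.2.2.2.2 j c q hq x' hx'
  have hGφ : ∀ i x' (c'' : Fin M), G i v x' (Fin.castSucc (Fin.castSucc c'')) = φ' i v x' c'' := by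
    intro i x' c''; simp only [hG, Fin.snoc_castSucc]
  have hGf : ∀ i x', G i v x' (Fin.castSucc (Fin.last M)) = fv i v x' := by
    intro i x'; simp only [hG, hfv, Fin.snoc_castSucc, Fin.snoc_last]
  have hGg : ∀ i x', G i v x' (Fin.last (M + 1)) = gv i v x' := by
    intro i x'; simp only [hG, hgv, Fin.snoc_last]
  -- the pre-charts: membership, smoothness, bounds `2^{r+1}`
  have hηmem : ∀ ij, ∀ x ∈ 𝕀^(ℓ + 1), η ij v x ∈ S := by
    rintro ⟨i, j⟩ x hx
    have hx' : Fin.init x ∈ 𝕀^ℓ := mapsTo_init_cube ℓ hx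
    have hb : ψ i j v (Fin.init x) ∈ 𝕀^ℓ := (hψ i v).1 j hx'
    have hmem : φ' i v (ψ i j v (Fin.init x)) ∈ S' v := hmaps' i hb
    have ht := hx (Fin.last ℓ) (mem_univ _)
    have hlt' := hfg v _ hmem
    refine ⟨?_, ?_, ?_⟩
    · simp only [hη, Fin.init_snoc]; exact hmem
    · simp only [hη, Fin.init_snoc, Fin.snoc_last, hfv, hgv]
      nlinarith [ht.1, ht.2]
    · simp only [hη, Fin.init_snoc, Fin.snoc_last, hfv, hgv]
      nlinarith [ht.1, ht.2]
  have hηC : ∀ ij c, ContDiffOn ℝ r (fun x => η ij v x c) (𝕀^(ℓ + 1)) ∧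
      ∀ q ≤ r, ∀ x ∈ 𝕀^(ℓ + 1), ‖iteratedFDeriv ℝ q (fun x => η ij v x c) x‖ ≤ 2 ^ (r + 1) := by
    rintro ⟨i, j⟩ c
    refine Fin.lastCases ?_ (fun c' => ?_) c
    · -- the band coordinate
      obtain ⟨hFc, hFb⟩ := contDiffOn_norm_iteratedFDeriv_comp_init (ℓ := ℓ) (r := r) (C := 1)
        (h := fun x' => G i v (ψ i j v x') (Fin.castSucc (Fin.last M))) (hpiece i j _).1 (hpiece i j _).2
      obtain ⟨hGc, hGb⟩ := contDiffOn_norm_iteratedFDeriv_comp_init (ℓ := ℓ) (r := r) (C := 1)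
        (h := fun x' => G i v (ψ i j v x') (Fin.last (M + 1))) (hpiece i j _).1 (hpiece i j _).2
      obtain ⟨hBc, hBb⟩ := contDiffOn_norm_iteratedFDeriv_band (Fin.last ℓ) hFc hGc hFb hGb
      have heq : (fun x => η ⟨i, j⟩ v x (Fin.last M)) = fun x : Fin (ℓ + 1) → ℝ =>
          (1 - x (Fin.last ℓ)) * G i v (ψ i j v (Fin.init x)) (Fin.castSucc (Fin.last M)) +
            x (Fin.last ℓ) * G i v (ψ i j v (Fin.init x)) (Fin.last (M + 1)) := by
        funext x
        simp only [hη, Fin.snoc_last, hGf, hGg]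
      rw [heq]
      refine ⟨hBc, fun q hq x hx => (hBb q hq x hx).trans ?_⟩
      rw [mul_one]
      exact pow_le_pow_right₀ (by norm_num) (by omega)
    · -- a base coordinate
      obtain ⟨hc, hb⟩ := contDiffOn_norm_iteratedFDeriv_comp_init (ℓ := ℓ) (r := r) (C := 1)
        (h := fun x' => G i v (ψ i j v x') (Fin.castSucc (Fin.castSucc c'))) (hpiece i j _).1 (hpiece i j _).2
      have heq : (fun x => η ⟨i, j⟩ v x (Fin.castSucc c')) = fun x : Fin (ℓ + 1) → ℝ =>
          G i v (ψ i j v (Fin.init x)) (Fin.castSucc (Fin.castSucc c')) := by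
        funext x
        simp only [hη, Fin.snoc_castSucc, hGφ]
      rw [heq]
      refine ⟨hc, fun q hq x hx => (hb q hq x hx).trans ?_⟩
      exact one_le_pow₀ (by norm_num)
  -- the final charts
  have hall : ∀ ija, MapsTo (θ ija v) (𝕀^(ℓ + 1)) S ∧
      (∀ c, ContDiffOn ℝ r (fun x => θ ija v x c) (𝕀^(ℓ + 1))) ∧
      (∀ c, ∀ q ≤ r, ∀ x ∈ 𝕀^(ℓ + 1), ‖iteratedFDeriv ℝ q (fun x => θ ija v x c) x‖ ≤ 1) := by
    rintro ⟨ij, a⟩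
    have hmapsθ : MapsTo (θ ⟨ij, a⟩ v) (𝕀^(ℓ + 1)) S := fun x hx => hηmem ij _ (hAmaps a hx)
    refine ⟨hmapsθ, fun c => ?_, fun c q hq x hx => ?_⟩
    · exact (norm_iteratedFDeriv_comp_affine_le (r := r) (fun i => ((a i : ℕ) : ℝ) / (2 * K)) (1 / K : ℝ)
        (hηC ij c).1 (hηC ij c).2 (hAmaps a)).1
    · rcases Nat.eq_zero_or_pos q with rfl | hq1
      · rw [norm_iteratedFDeriv_zero, Real.norm_eq_abs]
        have h := hS v (hmapsθ hx) c (mem_univ _)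
        rw [abs_le]; exact ⟨by linarith [h.1], h.2.le⟩
      · have h := (norm_iteratedFDeriv_comp_affine_le (r := r) (fun i => ((a i : ℕ) : ℝ) / (2 * K)) (1 / K : ℝ)
          (hηC ij c).1 (hηC ij c).2 (hAmaps a)).2 q hq x hx
        refine h.trans ?_
        rw [abs_of_pos (by positivity : (0 : ℝ) < 1 / K), ← hKR]
        calc (K : ℝ) * (1 / K) ^ q ≤ K * (1 / K) ^ 1 := by
              apply mul_le_mul_of_nonneg_left _ hK0.le
              exact pow_le_pow_of_le_one (by positivity) ((div_le_one hK0).mpr (by exact_mod_cast hK1)) hq1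
          _ = 1 := by field_simp
  refine ⟨fun ija => (hall ija).1, ?_, fun ija c => (hall ija).2.1 c, fun ija c => (hall ija).2.2 c⟩
  -- covering
  apply Subset.antisymm
  · exact iUnion_subset fun ija => (hall ija).1.image_subset
  · intro z hz
    obtain ⟨hz1, hz2, hz3⟩ := hz
    rw [← hcov'] at hz1
    obtain ⟨i, x', hx', hx'z⟩ := mem_iUnion.mp hz1
    have hx'cov : x' ∈ ⋃ j, ψ i j v '' 𝕀^ℓ := by rw [(hψ i v).2.1]; exact hx'
    obtain ⟨j, x₀, hx₀, rfl⟩ := mem_iUnion.mp hx'cov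
    -- the vertical coordinate
    set fz : ℝ := f (Fin.append v (Fin.init z)) with hfz
    set gz : ℝ := g (Fin.append v (Fin.init z)) with hgz
    set t : ℝ := (z (Fin.last M) - fz) / (gz - fz) with ht
    have hgf : 0 < gz - fz := by linarith
    have ht01 : t ∈ Ioo (0 : ℝ) 1 := by
      rw [ht]; constructor
      · exact div_pos (by linarith) hgf
      · rw [div_lt_one hgf]; linarith
    set y : Fin (ℓ + 1) → ℝ := Fin.snoc x₀ t with hy
    have hycube : y ∈ 𝕀^(ℓ + 1) := by
      intro k _
      refine Fin.lastCases ?_ (fun k' => ?_) k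
      · simp only [hy, Fin.snoc_last]; exact ht01
      · simp only [hy, Fin.snoc_castSucc]; exact hx₀ k' (mem_univ _)
    have hηy : η ⟨i, j⟩ v y = z := by
      have hb : φ' i v (ψ i j v x₀) = Fin.init z := hx'z
      simp only [hη, hy, Fin.init_snoc, Fin.snoc_last]
      rw [hb]
      conv_rhs => rw [← Fin.snoc_init_self z]
      congr 1
      simp only [hfv, hgv, hb]
      rw [ht]
      field_simp
      ring
    obtain ⟨a, x, hx, hxy⟩ := hAcov y hycube
    refine mem_iUnion.mpr ⟨⟨⟨i, j⟩, a⟩, x, hx, ?_⟩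
    show η ⟨i, j⟩ v (A a x) = z
    rw [show A a x = y from hxy, hηy]


end CellSteps

/-! ### Cell fibres: the induction (Pila–Wilkie 2006, §5, `(II)_m` for cells, uniformly) -/

section CellInduction

open Classical

variable {L : Language} [L.Structure ℝ]

/-- Local notation: the open unit cube `(0,1)^ℓ`. -/
local notation "𝕀^" ℓ:max => (Set.pi Set.univ fun _ : Fin ℓ => Set.Ioo (0 : ℝ) 1)

/-- Counting interval coordinates: adding a last coordinate. [folklore] -/
theorem typeDim_lastBits_succ {p M : ℕ} (ι : Fin (p + M + 1) → Bool) :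
    CellDimension.typeDim (fun j : Fin (M + 1) => ι (Fin.natAdd p j)) =
      CellDimension.typeDim (fun j : Fin M => Fin.init ι (Fin.natAdd p j)) +
        (if ι (Fin.last (p + M)) = true then 1 else 0) := by
  unfold CellDimension.typeDim
  rw [Finset.card_filter, Finset.card_filter, Fin.sum_univ_castSucc]
  rfl

/-- **`r`-parametrization of the fibres of a cell, uniformly in the parameters** (Pila–Wilkie
2006, §5, the statement `(II)_m` restricted to cells, in the uniform form needed for families;
printed: *"it is clearly sufficient to consider the case that `X` is an `(i₁, …, i_{m+1})`-cell …
Suppose that `l = i₁ + ⋯ + i_{m+1}` (`= dim C`)"*): let `C ⊆ ℝ^{p+M}` be a cell whose fibres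
`C_v = {z | v ⧺ z ∈ C}` over `v ∈ ℝ^p` lie in `(0,1)^M`, and assume the uniform
`r`-reparametrization property of `ℓ`-variable definable families for all `ℓ < M`. Then, with
`ℓ` the number of interval coordinates among the last `M`, there are finitely many definable
families of charts `φ_i(v, ·) : (0,1)^ℓ → ℝ^M` such that for every `v` with `C_v ≠ ∅` the
`φ_i(v, ·)` map `(0,1)^ℓ` into `C_v`, cover it, are `C^r`, and have all derivatives of order
`≤ r` bounded by `1` in operator norm. By induction on `M` via `graphStep` and `bandStep`.
[cite: PilaWilkie2006, §5 (II)_m] -/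
theorem cellFibreParam {p r : ℕ}
    (hadd : (univ : Set ℝ).Definable L {v : Fin 3 → ℝ | v 0 + v 1 = v 2})
    (hmul : (univ : Set ℝ).Definable L {v : Fin 3 → ℝ | v 0 * v 1 = v 2}) :
    ∀ (M : ℕ),
    (∀ ℓ, ℓ < M → ∀ (n m : ℕ) (F : Fin n → (Fin m → ℝ) → (Fin ℓ → ℝ) → ℝ),
      (∀ l, IsDefinableFamily L (F l)) → (∀ l v, ∀ x ∈ 𝕀^ℓ, |F l v x| ≤ 1) →
      ∃ (κ : Type) (_ : Fintype κ) (ψ : κ → (Fin m → ℝ) → (Fin ℓ → ℝ) → (Fin ℓ → ℝ)),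
        (∀ j c, IsDefinableFamily L (fun v x => ψ j v x c)) ∧
        ∀ v, (∀ j, MapsTo (ψ j v) (𝕀^ℓ) (𝕀^ℓ)) ∧ (⋃ j, ψ j v '' 𝕀^ℓ) = 𝕀^ℓ ∧
          (∀ j c, ContDiffOn ℝ r (fun x => ψ j v x c) (𝕀^ℓ)) ∧
          (∀ j c, ∀ q ≤ r, ∀ x ∈ 𝕀^ℓ, ‖iteratedFDeriv ℝ q (fun x => ψ j v x c) x‖ ≤ 1) ∧
          (∀ j l, ContDiffOn ℝ r (fun x => F l v (ψ j v x)) (𝕀^ℓ)) ∧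
          (∀ j l, ∀ q ≤ r, ∀ x ∈ 𝕀^ℓ, ‖iteratedFDeriv ℝ q (fun x => F l v (ψ j v x)) x‖ ≤ 1)) →
    ∀ (ι : Fin (p + M) → Bool) (C : Set (Fin (p + M) → ℝ)), IsCell L (p + M) ι C →
    (∀ v : Fin p → ℝ, {z : Fin M → ℝ | (Fin.append v z :) ∈ C} ⊆ 𝕀^M) →
    ∃ (ℓ : ℕ) (κ : Type) (_ : Fintype κ) (φ : κ → (Fin p → ℝ) → (Fin ℓ → ℝ) → (Fin M → ℝ)),
      ℓ = CellDimension.typeDim (fun j : Fin M => ι (Fin.natAdd p j)) ∧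
      (∀ i c, IsDefinableFamily L (fun v x => φ i v x c)) ∧
      ∀ v : Fin p → ℝ, {z : Fin M → ℝ | (Fin.append v z :) ∈ C}.Nonempty →
        (∀ i, MapsTo (φ i v) (𝕀^ℓ) {z : Fin M → ℝ | (Fin.append v z :) ∈ C}) ∧
        (⋃ i, φ i v '' 𝕀^ℓ) = {z : Fin M → ℝ | (Fin.append v z :) ∈ C} ∧
        (∀ i c, ContDiffOn ℝ r (fun x => φ i v x c) (𝕀^ℓ)) ∧
        (∀ i c, ∀ q ≤ r, ∀ x ∈ 𝕀^ℓ, ‖iteratedFDeriv ℝ q (fun x => φ i v x c) x‖ ≤ 1) := by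
  have hlt := definable_lt_of_field hadd hmul
  intro M
  induction M with
  | zero =>
    intro _ ι C _ _
    refine ⟨0, Unit, inferInstance, fun _ _ _ => Fin.elim0, ?_, fun _ c => c.elim0, fun v hne => ?_⟩
    · unfold CellDimension.typeDim; simp
    obtain ⟨z₀, hz₀⟩ := hne
    have huniq : ∀ z : Fin 0 → ℝ, z = z₀ := fun z => funext fun c => c.elim0
    refine ⟨fun _ x _ => ?_, ?_, fun _ c => c.elim0, fun _ c => c.elim0⟩
    · show (Fin.append v (Fin.elim0 : Fin 0 → ℝ) :) ∈ C
      rw [huniq Fin.elim0]; exact hz₀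
    · apply Subset.antisymm
      · refine iUnion_subset fun _ => ?_
        rintro _ ⟨x, -, rfl⟩
        show (Fin.append v (Fin.elim0 : Fin 0 → ℝ) :) ∈ C
        rw [huniq Fin.elim0]; exact hz₀
      · intro z _
        refine mem_iUnion.mpr ⟨(), Fin.elim0, fun i _ => i.elim0, ?_⟩
        rw [huniq z]; exact (huniq _).symm ▸ rfl
  | succ M ih =>
    intro hUR ι C hC hCsub
    have hC' : IsCell L (p + M + 1) ι C := hC
    rw [isCell_succ_iff] at hC'
    obtain ⟨X, hX, hcases⟩ := hC'
    -- the inductive hypothesis for the base cell `X`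
    have hUR' : ∀ ℓ, ℓ < M → _ := fun ℓ hℓ => hUR ℓ (Nat.lt_succ_of_lt hℓ)
    -- fibres of `C` in terms of fibres of `X`
    set S' : (Fin p → ℝ) → Set (Fin M → ℝ) := fun v => {z' : Fin M → ℝ | (Fin.append v z' :) ∈ X} with hS'
    have htd := typeDim_lastBits_succ (p := p) (M := M) ι
    rcases hcases with ⟨hιlast, f, hf, -, hCeq⟩ | ⟨hιlast, f, g, hf, hg, hfg, hCeq⟩
    · ----------------------------------------------------------------- graph
      subst hCeq
      have hfib : ∀ v, {z : Fin (M + 1) → ℝ | (Fin.append v z :) ∈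
          {w : Fin (p + M + 1) → ℝ | (Fin.init w : Fin (p + M) → ℝ) ∈ X ∧ w (Fin.last (p + M)) = f (Fin.init w)}} =
          {z : Fin (M + 1) → ℝ | Fin.init z ∈ S' v ∧ z (Fin.last M) = f (Fin.append v (Fin.init z))} :=
        fun v => Set.ext fun z => mem_fibre_graph_iff v z
      -- fibres of `X` lie in the cube
      have hXsub : ∀ v, S' v ⊆ 𝕀^M := by
        intro v z' hz'
        have hmem : (Fin.snoc z' (f (Fin.append v z')) : Fin (M + 1) → ℝ) ∈
            {z : Fin (M + 1) → ℝ | Fin.init z ∈ S' v ∧ z (Fin.last M) = f (Fin.append v (Fin.init z))} := by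
          refine ⟨?_, ?_⟩ <;> simp only [Fin.init_snoc, Fin.snoc_last]
          exact hz'
        rw [← hfib v] at hmem
        intro c _
        have h := hCsub v hmem (Fin.castSucc c) (mem_univ _)
        simpa only [Fin.snoc_castSucc] using h
      obtain ⟨ℓ, κ', hκ', φ', hℓ, hφ'def, hφ'⟩ := ih hUR' (Fin.init ι) X hX hXsub
      have hℓM : ℓ < M + 1 := by
        rw [hℓ]; exact Nat.lt_succ_of_le (CellDimension.typeDim_le _)
      have hS : ∀ v, {z : Fin (M + 1) → ℝ | Fin.init z ∈ S' v ∧ z (Fin.last M) = f (Fin.append v (Fin.init z))} ⊆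
          𝕀^(M + 1) := fun v => (hfib v) ▸ hCsub v
      obtain ⟨κ, hκ, φ, hφdef, hφ⟩ := graphStep hlt (hUR ℓ hℓM) S' hf hφ'def hφ' hS
      refine ⟨ℓ, κ, hκ, φ, ?_, hφdef, fun v hne => ?_⟩
      · rw [htd, hιlast, hℓ]; simp
      · rw [hfib v] at hne ⊢
        exact hφ v hne
    · ----------------------------------------------------------------- band
      subst hCeq
      have hfib : ∀ v, {z : Fin (M + 1) → ℝ | (Fin.append v z :) ∈
          {w : Fin (p + M + 1) → ℝ | (Fin.init w : Fin (p + M) → ℝ) ∈ X ∧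
            (∀ f' ∈ f, f' (Fin.init w) < w (Fin.last (p + M))) ∧ ∀ g' ∈ g, w (Fin.last (p + M)) < g' (Fin.init w)}} =
          {z : Fin (M + 1) → ℝ | Fin.init z ∈ S' v ∧ (∀ f' ∈ f, f' (Fin.append v (Fin.init z)) < z (Fin.last M)) ∧
            ∀ g' ∈ g, z (Fin.last M) < g' (Fin.append v (Fin.init z))} :=
        fun v => Set.ext fun z => mem_fibre_band_iff v z
      -- the boundary functions are finite (`some`) unless all fibres are empty
      rcases f with _ | f₀
      · -- `f = -∞`: every fibre is empty
        refine ⟨CellDimension.typeDim (fun j : Fin (M + 1) => ι (Fin.natAdd p j)), Empty, inferInstance,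
          fun i => i.elim, rfl, fun i => i.elim, fun v hne => ?_⟩
        exfalso
        rw [hfib v] at hne
        obtain ⟨z, hz', -, hzg⟩ := hne
        -- push the last coordinate below `0`
        set y : ℝ := min (z (Fin.last M)) 0 - 1 with hy
        have hmem : (Fin.snoc (Fin.init z) y : Fin (M + 1) → ℝ) ∈
            {z : Fin (M + 1) → ℝ | Fin.init z ∈ S' v ∧ (∀ f' ∈ (none : Option ((Fin (p + M) → ℝ) → ℝ)),
              f' (Fin.append v (Fin.init z)) < z (Fin.last M)) ∧ ∀ g' ∈ g, z (Fin.last M) < g' (Fin.append v (Fin.init z))} := by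
          refine ⟨?_, ?_, ?_⟩ <;> simp only [Fin.init_snoc, Fin.snoc_last]
          · exact hz'
          · intro f' hf'; exact absurd hf' (Option.not_mem_none _)
          · intro g' hg'
            have := hzg g' hg'
            have : y < z (Fin.last M) := by rw [hy]; have := min_le_left (z (Fin.last M)) 0; linarith
            linarith
        rw [← hfib v] at hmem
        have h := hCsub v hmem (Fin.last M) (mem_univ _)
        simp only [Fin.snoc_last] at h
        have : y < 0 := by rw [hy]; have := min_le_right (z (Fin.last M)) 0; linarith
        linarith [h.1]
      rcases g with _ | g₀
      · -- `g = +∞`: every fibre is empty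
        refine ⟨CellDimension.typeDim (fun j : Fin (M + 1) => ι (Fin.natAdd p j)), Empty, inferInstance,
          fun i => i.elim, rfl, fun i => i.elim, fun v hne => ?_⟩
        exfalso
        rw [hfib v] at hne
        obtain ⟨z, hz', hzf, -⟩ := hne
        set y : ℝ := max (z (Fin.last M)) 1 + 1 with hy
        have hmem : (Fin.snoc (Fin.init z) y : Fin (M + 1) → ℝ) ∈
            {z : Fin (M + 1) → ℝ | Fin.init z ∈ S' v ∧ (∀ f' ∈ some f₀, f' (Fin.append v (Fin.init z)) < z (Fin.last M)) ∧
              ∀ g' ∈ (none : Option ((Fin (p + M) → ℝ) → ℝ)), z (Fin.last M) < g' (Fin.append v (Fin.init z))} := by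
          refine ⟨?_, ?_, ?_⟩ <;> simp only [Fin.init_snoc, Fin.snoc_last]
          · exact hz'
          · intro f' hf'
            have := hzf f' hf'
            have : z (Fin.last M) < y := by rw [hy]; have := le_max_left (z (Fin.last M)) 1; linarith
            linarith
          · intro g' hg'; exact absurd hg' (Option.not_mem_none _)
        rw [← hfib v] at hmem
        have h := hCsub v hmem (Fin.last M) (mem_univ _)
        simp only [Fin.snoc_last] at h
        have : 1 < y := by rw [hy]; have := le_max_right (z (Fin.last M)) 1; linarith
        linarith [h.2]
      -- `f = some f₀`, `g = some g₀`
      have hfib' : ∀ v, {z : Fin (M + 1) → ℝ | Fin.init z ∈ S' v ∧ (∀ f' ∈ some f₀, f' (Fin.append v (Fin.init z)) < z (Fin.last M)) ∧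
            ∀ g' ∈ some g₀, z (Fin.last M) < g' (Fin.append v (Fin.init z))} =
          {z : Fin (M + 1) → ℝ | Fin.init z ∈ S' v ∧ f₀ (Fin.append v (Fin.init z)) < z (Fin.last M) ∧
            z (Fin.last M) < g₀ (Fin.append v (Fin.init z))} := by
        intro v; ext z; simp only [mem_setOf_eq, Option.mem_def, Option.some.injEq, forall_eq']
      have hXsub : ∀ v, S' v ⊆ 𝕀^M := by
        intro v z' hz'
        have hlt' : f₀ (Fin.append v z') < g₀ (Fin.append v z') := hfg f₀ rfl g₀ rfl _ hz'
        have hmem : (Fin.snoc z' ((f₀ (Fin.append v z') + g₀ (Fin.append v z')) / 2) : Fin (M + 1) → ℝ) ∈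
            {z : Fin (M + 1) → ℝ | Fin.init z ∈ S' v ∧ f₀ (Fin.append v (Fin.init z)) < z (Fin.last M) ∧
              z (Fin.last M) < g₀ (Fin.append v (Fin.init z))} := by
          refine ⟨?_, ?_, ?_⟩ <;> simp only [Fin.init_snoc, Fin.snoc_last]
          · exact hz'
          · linarith
          · linarith
        rw [← hfib' v, ← hfib v] at hmem
        intro c _
        have h := hCsub v hmem (Fin.castSucc c) (mem_univ _)
        simpa only [Fin.snoc_castSucc] using h
      obtain ⟨ℓ, κ', hκ', φ', hℓ, hφ'def, hφ'⟩ := ih hUR' (Fin.init ι) X hX hXsub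
      have hℓM : ℓ < M + 1 := by
        rw [hℓ]; exact Nat.lt_succ_of_le (CellDimension.typeDim_le _)
      have hS : ∀ v, {z : Fin (M + 1) → ℝ | Fin.init z ∈ S' v ∧ f₀ (Fin.append v (Fin.init z)) < z (Fin.last M) ∧
          z (Fin.last M) < g₀ (Fin.append v (Fin.init z))} ⊆ 𝕀^(M + 1) := fun v => (hfib' v) ▸ (hfib v) ▸ hCsub v
      have hfg' : ∀ v, ∀ z' ∈ S' v, f₀ (Fin.append v z') < g₀ (Fin.append v z') :=
        fun v z' hz' => hfg f₀ rfl g₀ rfl _ hz'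
      obtain ⟨κ, hκ, φ, hφdef, hφ⟩ := bandStep hadd hmul (hUR ℓ hℓM) S' (hf f₀ rfl).1 (hg g₀ rfl).1 hfg'
        hφ'def hφ' hS
      refine ⟨ℓ + 1, κ, hκ, φ, ?_, hφdef, fun v hne => ?_⟩
      · rw [htd, hιlast, hℓ]; simp
      · rw [hfib v, hfib' v] at hne ⊢
        exact hφ v hne

end CellInduction


end Literature.ModelTheory.ExponentialFields

end
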